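import Summits.BirchSwinnertonDyer.BirchSwinnertonDyer.Theorems.ThetaPartnerAtTwoSignedKatoUpToAtTwoOffTwoESClass
import Literature.NumberTheory.EllipticCurves.Kato2004.FineSelmerDualTorsionOfEulerSystemBoundProofs
import HarnessLib

/-!
# Route `ThetaPartnerAtTwo` (TP2), crux K3 `SignedKatoDivisibilityUpToAtTwo` (item stmt-BirchSwinnertonDyer-20308),
# line `colemanrat` v3: **`X₀(W/ℚ_∞)` is Λ-TORSION at `p = 2`, MODULO PRINT** — the named fact
# `Kato2004_fineSelmerDual_isTorsion` at `p = 2` on non-CM curves with `W[2]` irreducible and `r_an = 0` (in particular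
# on the theta habitat), from Kato Thm. 13.4 (2) at `2` BY NAME + the explicit non-zero genuine `2`-adic class of
# `…OffTwoESClass` + Gross–Zagier–Kolyvagin (cell `bsd-wall`, width seat `bsd-wall-tp2-p2x-w2`;
# `--supports stmt-BirchSwinnertonDyer-20308`)

HONEST FRAMING (cell `bsd-wall`): THEOREMS ONLY — no definition, no named fact, no instance, no `sorry`; CONDITIONAL
on the displayed def:Prop facts `h134` (Kato Thm. 13.4 (2) at `p = 2`), `hES` (Kato (8.1.3)/Ex. 13.3/Thm. 9.7/6.6 (1)),
`h17` (Gross–Zagier–Kolyvagin); closes no item; BSD is NOT proved by any of this.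

What: `fineSelmerDual_lengthAt_ne_top_of_pub` (sibling file) gives `ℓ_𝔭(X₀(W/ℚ_∞)) < ⊤` at every height-one `𝔭 ∌ 2`;
at the single prime `𝔭 = (T)` (`2 ∉ (T)`, height one) this already forces `X₀` to be `Λ`-torsion — «finite local
length at one non-zero prime of a domain ⇒ torsion», `Module.isTorsion_of_lengthAt_ne_top` (cell `bsd-potss`), with NO
finite-generation hypothesis. So the `X₀`-torsion conjunct of the line's original v1 stub `stub_katoPubTwo`
(`Kato2004.thm12_4 ∧ Kato2004_fineSelmerDual_isTorsion`) holds on the habitat modulo {`h134`, `hES`, `h17`} — Kato's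
Thm. 13.4 (1) / 12.4 (1) at `p = 2` recovered from clause (2) and an explicit class (the odd-`p` analogue is
`Kato2004.fineSelmerDual_isTorsion_of_thm13_4_of_thm12_4_of_exists_isEulerSystemClass`, whose `hES` binder is now
`Kato2004.exists_isEulerSystemClass_ne_zero`).

References: [Kato2004Asterisque] Thm. 12.4 (1) (p. 221), Thm. 13.4 (1)(2) (p. 226), §17.13 (17.13.1) (p. 279);
[Washington1997] §13.2 (`(T)` has height one); [Darmon2004] Thm. 3.22.
-/

set_option autoImplicit false
-- the Theorems namespace of this sub repeats the summit name by design (D-0017 nested layout)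
set_option linter.dupNamespace false

noncomputable section

open scoped Classical MatrixGroups ModularForm NumberField

open CongruenceSubgroup WeierstrassCurve Field IsDedekindDomain
  Literature.NumberTheory.GaloisRepresentations
  Literature.NumberTheory.EllipticCurves Literature.NumberTheory.EllipticCurves.ModularForms
  Literature.NumberTheory.EllipticCurves.Module Literature.NumberTheory.EllipticCurves.Rank1Residual
  Literature.NumberTheory.EllipticCurves.Kato2004
  Literature.NumberTheory.EllipticCurves.Kato2004.EulerSystemValues ZpExtension

namespace Summit.BirchSwinnertonDyer.BirchSwinnertonDyer.Theorems

namespace SignedKatoOffTwo.ESClassTwo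

/-- `2 ∉ (T)`: the constant `C 2` is not a multiple of `T` in `Λ = ℤ₂⟦T⟧` (its constant coefficient is `2 ≠ 0`).
[folklore] -/
theorem C_two_not_mem_primeT :
    PowerSeries.C (2 : ℤ_[2]) ∉ (IwasawaAlgebra.primeT 2).asIdeal := by
  intro h
  rw [IwasawaAlgebra.primeT_asIdeal, Ideal.mem_span_singleton, PowerSeries.X_dvd_iff,
    PowerSeries.constantCoeff_C] at h
  exact two_ne_zero h

variable (W : WeierstrassCurve ℚ) [W.IsElliptic] [ContinuousSMul ℤ_[2] (W.tateModule 2)]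
  [Module.Free ℤ_[2] (W.tateModule 2)] [Module.Finite ℤ_[2] (W.tateModule 2)]
  {κ : ZpExtension ℚ 2} {γ : absoluteGaloisGroup ℚ}

/-- **`X₀(W/ℚ_∞)` is `Λ`-torsion at `p = 2`, MODULO PRINT** — the named fact `Kato2004_fineSelmerDual_isTorsion`
at `p = 2` for every non-CM `W/ℚ` with `W[2]` irreducible and `r_an(W) = 0`, GRANTED Kato Thm. 13.4 (2) at `2`
(`h134`), Kato's construction fact (`hES`) and Gross–Zagier–Kolyvagin (`h17`): `fineSelmerDual_lengthAt_ne_top_of_pub`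
at the single height-one prime `𝔭 = (T)` (`2 ∉ (T)`) and «finite local length at one non-zero prime of a domain ⇒
torsion» (`Module.isTorsion_of_lengthAt_ne_top`). Every dual datum `FB`.
[cite: Kato2004Asterisque, Thm. 13.4 (1)(2) (p. 226), Thm. 12.4 (1) (p. 221), §17.13 (17.13.1) (p. 279)]
[cite: Darmon2004, Thm. 3.22] -/
theorem fineSelmerDual_isTorsion_two_of_pub (hκ : κ.IsCyclotomic)
    (h134 : Kato2004.thm13_4_two_lengthAt_fineSelmerDual_le_of_isEulerSystemClassTwo)
    (hES : Kato2004.exists_eulerSystem_expStar_values) (h17 : rank_eq_analyticRank_of_analyticRank_le_one)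
    (hcm : ¬ W.HasCM) (hirr : W.HasIrreducibleModPGaloisRep 2) (hr : W.analyticRank = 0)
    {N : ℕ} [NeZero N] (f : CuspForm (Gamma0 N) 2) (hf : IsNewformOf W f) (hγ : κ.IsTopGenerator γ)
    (FB : W.FineSelmerDualData κ γ) : Module.IsTorsion (IwasawaAlgebra 2) FB.X :=
  Module.isTorsion_of_lengthAt_ne_top (IwasawaAlgebra.primeT 2)
    (by
      rw [IwasawaAlgebra.primeT_asIdeal, Ne, Ideal.span_singleton_eq_bot]
      exact PowerSeries.X_ne_zero)
    (fineSelmerDual_lengthAt_ne_top_of_pub W hκ h134 hES h17 hcm hirr hr f hf hγ FB (IwasawaAlgebra.primeT 2)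
      (IwasawaAlgebra.height_primeT 2) C_two_not_mem_primeT)

/-- **The same on the theta habitat of K3** (globally minimal, non-CM, `r_an = 0`, good supersingular at `2`; `a₂ = 0`
not needed): `X₀(E/ℚ_∞)` is `Λ`-torsion at `p = 2` modulo {`h134`, `hES`, `h17`} — the `X₀`-torsion conjunct of the
line's original v1 stub `stub_katoPubTwo`, on the habitat, from print by name.
[cite: Kato2004Asterisque, Thm. 13.4 (1)(2) (p. 226), Thm. 12.4 (1) (p. 221)] [cite: Darmon2004, Thm. 3.22] -/
theorem fineSelmerDual_isTorsion_two_of_goodSS_of_pub [W.IsGloballyMinimal] (hκ : κ.IsCyclotomic)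
    (h134 : Kato2004.thm13_4_two_lengthAt_fineSelmerDual_le_of_isEulerSystemClassTwo)
    (hES : Kato2004.exists_eulerSystem_expStar_values) (h17 : rank_eq_analyticRank_of_analyticRank_le_one)
    (hcm : ¬ W.HasCM) (hr : W.analyticRank = 0) (hss : GoodSS W 2)
    {N : ℕ} [NeZero N] (f : CuspForm (Gamma0 N) 2) (hf : IsNewformOf W f) (hγ : κ.IsTopGenerator γ)
    (FB : W.FineSelmerDualData κ γ) : Module.IsTorsion (IwasawaAlgebra 2) FB.X :=
  fineSelmerDual_isTorsion_two_of_pub W hκ h134 hES h17 hcm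
    (Summit.BirchSwinnertonDyer.Rank1Residual.P2.irr_two_of_goodSS_two W hss) hr f hf hγ FB

end SignedKatoOffTwo.ESClassTwo

end Summit.BirchSwinnertonDyer.BirchSwinnertonDyer.Theorems

end
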